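import HarnessLib
import Mathlib.NumberTheory.NumberField.DedekindZeta
import Mathlib.Analysis.Complex.Basic

/-!
# `QuinticDedekindPole` (stmt-Langlands-17270) — Negative knowledge: the division by `ζ` is what
# makes the bet non-trivial (without it the non-extendability is trivially TRUE: pole at `s = 1`)

Crux-disprover lemma (cdisprove, 2026-08-17) for the crux `QuinticDedekindPole` of route
`DedekindQuotient1951`, whose conclusion is `¬ ∃ g, DifferentiableOn ℂ g box ∧
∀ s, 1 < Re s → |Im s| < 100 → g s * riemannZeta s = NumberField.dedekindZeta K s`.
MUTATION "drop the factor `riemannZeta s`": then the statement is TRUE for EVERY number field `K`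
(and says nothing about Artin's conjecture): no `g` even continuous at `1` agrees with the Dirichlet
series `ζ_K` on `1 < Re s`, `|Im s| < 100`, since `(σ-1)ζ_K(σ) → Res_{s=1} ζ_K ≠ 0` as `σ → 1⁺`
(Mathlib's class number formula `NumberField.tendsto_sub_one_mul_dedekindZeta_nhdsGT`,
`dedekindZeta_residue_ne_zero`) while `(σ-1)g(σ) → 0`.  So the only content of the crux is the
comparison of `ζ_K` with `ζ` at the zeros of `ζ` (and the cancellation of the poles at `1`).
No statement of the route is used or asserted. [folklore]
-/

set_option linter.dupNamespace false -- project-wide option (lakefile weak.linter.dupNamespace); `Summit.Langlands.Langlands` is the mandated namespace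

noncomputable section

open scoped Topology
open Filter Set Complex

namespace Summit.Langlands.Langlands.Theorems.QuinticDedekindPole.Negative

/-- **Without the division by `ζ`, non-extendability is trivial** (every number field `K`): no
`g : ℂ → ℂ` continuous at `1` agrees with `NumberField.dedekindZeta K` on `1 < Re s`, `|Im s| < 100`
(pole of `ζ_K` at `s = 1`, class number formula). [folklore] -/
theorem quinticDedekindPole_trivial_without_zeta_factor (K : Type*) [Field K] [NumberField K] :
    ¬ ∃ g : ℂ → ℂ, ContinuousAt g 1 ∧
      ∀ s : ℂ, 1 < s.re → |s.im| < 100 → g s = NumberField.dedekindZeta K s := by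
  rintro ⟨g, hg, hgeq⟩
  -- `(σ - 1) g σ → 0` as `σ → 1⁺` along the reals
  have h0 : Tendsto (fun σ : ℝ => ((σ : ℂ) - 1) * g σ) (𝓝[>] 1) (𝓝 0) := by
    have h1 : Tendsto (fun σ : ℝ => (σ : ℂ)) (𝓝 1) (𝓝 ((1 : ℝ) : ℂ)) :=
      Complex.continuous_ofReal.tendsto 1
    rw [Complex.ofReal_one] at h1
    have hc : Tendsto (fun σ : ℝ => g σ) (𝓝 1) (𝓝 (g 1)) := hg.tendsto.comp h1
    have hs : Tendsto (fun σ : ℝ => ((σ : ℂ) - 1)) (𝓝 1) (𝓝 0) := by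
      simpa using h1.sub_const (1 : ℂ)
    simpa using (hs.mul hc).mono_left nhdsWithin_le_nhds
  -- but on `(1, 2)` it is `(σ - 1) ζ_K(σ) → Res ζ_K ≠ 0`
  have h1 : Tendsto (fun σ : ℝ => ((σ : ℂ) - 1) * g σ) (𝓝[>] 1)
      (𝓝 (NumberField.dedekindZeta_residue K : ℂ)) := by
    have h := NumberField.tendsto_sub_one_mul_dedekindZeta_nhdsGT K
    have h' : Tendsto (fun σ : ℝ => (((σ - 1) * NumberField.dedekindZeta K σ : ℂ)))
        (𝓝[>] 1) (𝓝 (NumberField.dedekindZeta_residue K : ℂ)) := by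
      exact_mod_cast h
    refine h'.congr' ?_
    have hI : Ioo (1 : ℝ) 2 ∈ 𝓝[>] (1 : ℝ) := Ioo_mem_nhdsGT (by norm_num)
    filter_upwards [hI] with σ hσ
    rw [hgeq σ (by simpa using hσ.1) (by simp)]
  have heq := tendsto_nhds_unique h1 h0
  exact NumberField.dedekindZeta_residue_ne_zero K (by exact_mod_cast heq)

/-- Crux-shaped corollary: with the factor `riemannZeta s` DROPPED from `QuinticDedekindPole`, the
statement holds for every number field (holomorphy on the open box `{0 < Re s ∧ |Im s| < 100} ∋ 1`
gives continuity at `1`). [folklore] -/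
theorem quinticDedekindPole_without_zeta_factor_trivial (K : Type*) [Field K] [NumberField K] :
    ¬ ∃ g : ℂ → ℂ, DifferentiableOn ℂ g {s : ℂ | 0 < s.re ∧ |s.im| < 100} ∧
      ∀ s : ℂ, 1 < s.re → |s.im| < 100 → g s = NumberField.dedekindZeta K s := by
  rintro ⟨g, hg, hgeq⟩
  refine quinticDedekindPole_trivial_without_zeta_factor K ⟨g, ?_, hgeq⟩
  have hopen : IsOpen {s : ℂ | 0 < s.re ∧ |s.im| < 100} :=
    (isOpen_lt continuous_const Complex.continuous_re).inter
      (isOpen_lt (continuous_abs.comp Complex.continuous_im) continuous_const)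
  have h1 : (1 : ℂ) ∈ {s : ℂ | 0 < s.re ∧ |s.im| < 100} := by simp
  exact (hg.differentiableAt (hopen.mem_nhds h1)).continuousAt

end Summit.Langlands.Langlands.Theorems.QuinticDedekindPole.Negative

end
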